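import Summits.QuantumFields.BalabanUV.Beta.EriceFlowEnclosureB12AsPrintedPointwiseFadingEventualAF
import Literature.MathematicalPhysics.QuantumFieldTheory.Balaban1983to89.T4BetaStationary

/-!
# Beta / EriceFlowEnclosureB12AsPrintedPointwiseFadingLimit — WHAT (0.31) FORCES, part 11: THE ASYMPTOTIC CONSTANT.  Under node U2's coupling-chart moduli
# `HistLipschitz Λ γ β` ∕ `FadingMemory C θ Λ` and NE4 `ScaleShiftRate c θ γ β` (0 ≤ θ < 1) ALONE, the whole family of history-dependent β-functions has ONE
# asymptotic value at zero coupling: the number **`b⋆ := lim_{u→0⁺} betaInf β (u, u, u, …)`** (node U2's stationary functional `T4BetaStationary.betaInf` read on the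
# constant histories; the limit exists because `u ↦ betaInf β (u, u, …)` is `C∕(1−θ)`-Lipschitz, §1–§2), and
#   **`|β_{k+1}(v) − b⋆| ≤ 2Cδ∕(1−θ) + cθ^k∕(1−θ)`  for EVERY history `v ∈ ]0, δ]^{k+1}`, every k, every `0 < δ ≤ γ`**   (§3 `abs_beta_sub_bstar_le`).
# So the answer to gen 46's open question («the TWO-SIDED eventual sandwich b ≤ β ≤ b′ with b′ − b → ?; is β′∕β near 1 forced? — probably NOT») is YES, IT IS FORCED: from
# scale k₀ on and on the box ]0, δ], `b⋆ − η ≤ β_{k+1} ≤ b⋆ + η` with `η = 2Cδ∕(1−θ) + cθ^{k₀}∕(1−θ) → 0` — near zero coupling and deep in the ultraviolet the lattice β-functions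
# are ONE NUMBER up to η (the ramp ∕ alt toys of parts 8b∕10d live at scale 2 ∕ without NE4).  Part 11a′ (`…PointwiseFadingLimitFloors`): `b⋆` is EXACTLY the supremum of the
# eventual floors ∕ infimum of the eventual ceilings near zero, and a family of (0.31)-runs at slopes `0 < s ≤ s′` (the TYPED Theorem 2 at ONE endpoint) forces `s ≤ b⋆ ≤ s′`;
# part 11b (`…PointwiseFadingLimitSharp`): the EVENTUAL SHARP (0.31) with constants `(b⋆ − η, b⋆ + η)` and the bare-coupling asymptotics `K·g₀(K)² → 1∕b⋆`; part 11c: the ENDs on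
# the as-printed carrier
# (β-flow team, prover 2 = lower ∕ positivity side, unit `b2b-balaban-beta-bflow-p2`, gen 49; ROW AP-I × node U2's `T4BetaStationary`; kernel of part 11)

HONEST FRAMING (page 1 of everything the β sub-cell writes): discharging `BetaPertH` makes Bałaban's UV stability UNCONDITIONAL — a
real constructive-QFT result; it is NOT the continuum limit and NOT the Clay problem.  HONEST DEPENDENCY (cell reorg 2026-08-19,
verbatim): «continuum YM on T⁴ ⇐ BetaPertH ∧ nine spine estimates (0/9 proved); BetaPertH ⇐ (D1) ∧ (D4) ∧ CAP+tail; G-an2-4 gates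
asym, D1 and NE2/3/4.»  THIS MODULE DISCHARGES NOTHING: §1–§3 are [folklore] limit ∕ finite-sum calculus for an ABSTRACT `β : FlowStep.HBeta` under node U2's HYPOTHESIS
SHAPES `T4CouplingMatching.HistLipschitz ∕ FadingMemory ∕ ScaleShiftRate` (NONE printed — [Balaban1987RG1] = T. Bałaban, Commun. Math. Phys. **109** (1987) p. 298 says only that
β_j *"depends also on all preceding coupling constants"*, p. 264 *"We will investigate other properties in a separate paper"*; GAPS G-t4-U2-1 ∕ G-t4-U2-2).  Node U2's Literature
`T4BetaStationary` (`betaInf`, `tendsto_betaInf`, `abs_beta_revHist_sub_betaInf_le`, `T4EtaRateMin.exists_limit_of_geomRate`) and part 6's `rowSum_le` are used BY NAME; nothing of theirs is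
restated or modified.  `b⋆` is carried as a real number with its defining property displayed as a hypothesis (`hb`, supplied by `exists_bstar`, unique by `bstar_unique`) — no definition is
introduced.  Nothing is asserted about Bałaban's β-functions (1.22), their limit at zero coupling, sign, floor, moduli or scale-shift rate.

WHAT THIS FILE PROVES (0 sorry, 0 def):
§1 `revHist_const`, `seqBox_const`, **`abs_sub_const_le_of_mem_box`** (small box ⟶ constant history: ≤ Cδ∕(1−θ)), **`abs_const_sub_const_le`** (`u ↦ β_{k+1}(u,…,u)` is `C∕(1−θ)`-Lipschitz,
   uniformly in k), `abs_const_sub_betaInf_le` (NE4 tail cθ^k∕(1−θ), node U2 BY NAME), **`abs_betaInf_const_sub_le`** (`u ↦ betaInf β (u,u,…)` is `C∕(1−θ)`-Lipschitz).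
§2 **`exists_bstar`** (∃ b⋆ with `|betaInf β (u,u,…) − b⋆| ≤ Cu∕(1−θ)` on ]0, γ]), `bstar_unique`, `tendsto_betaInf_const` (`betaInf β (u,u,…) → b⋆` as u → 0⁺).
§3 **`abs_beta_sub_bstar_le`** (THE TWO-SIDED SANDWICH), `eventualLowerH_bstar` ∕ `eventualUpper_bstar` (node U2's `EventualLowerH` and the matching ceiling with margin `η(δ, k₀)`),
   **`exists_sandwich`** (∀ ε > 0 ∃ δ ∃ k₀: `|β_{k+1} − b⋆| ≤ ε` on ]0, δ]^{k+1}, k ≥ k₀ — β′∕β → 1).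
NOT CLAIMED: the value, sign or existence of such a limit for Bałaban's β; any modulus or scale-shift rate for it; which reading print intends; Theorem 2; `BetaPertH`; continuum; Clay.
-/

namespace Summit.QuantumFields.BalabanUV.Beta.EriceFlowEnclosureB12AsPrintedPointwiseFadingLimit

open Finset Filter Topology
open Literature.MathematicalPhysics.QuantumFieldTheory.Balaban1983to89
open Literature.MathematicalPhysics.QuantumFieldTheory.Balaban1983to89.FlowStep (HBeta prefixOf Box mem_box box_mono RGEqH)
open Literature.MathematicalPhysics.QuantumFieldTheory.Balaban1983to89.T4CouplingMatching (HistLipschitz FadingMemory ScaleShiftRate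
  EventualLowerH)
open Literature.MathematicalPhysics.QuantumFieldTheory.Balaban1983to89.T4BetaStationary (SeqBox revHist betaInf tendsto_betaInf
  abs_beta_revHist_sub_betaInf_le constant_nonneg_of_scaleShiftRate)
open Literature.MathematicalPhysics.QuantumFieldTheory.Balaban1983to89.T4CauchySum (GeomRate)
open Literature.MathematicalPhysics.QuantumFieldTheory.Balaban1983to89.T4EtaRateMin (exists_limit_of_geomRate)
open Summit.QuantumFields.BalabanUV.Beta.EriceFlowEnclosureB12AsPrintedPointwiseFading (rowSum_le)

noncomputable section

variable {β : HBeta} {γ C c θ : ℝ} {Λ : ℕ → ℕ → ℝ}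

/-! ## §1 Constant histories: the β-values and node U2's stationary functional are Lipschitz in the constant -/

/-- The level-k prefix of the CONSTANT reversed history `(u, u, …)` is the constant prefix. [folklore] -/
theorem revHist_const (u : ℝ) (k : ℕ) : revHist (fun _ : ℕ => u) k = fun _ : Fin (k + 1) => u := rfl

/-- A constant history with value in ]0, γ] is box-valued. [folklore] -/
theorem seqBox_const {γ u : ℝ} (hu : 0 < u) (huγ : u ≤ γ) : SeqBox γ (fun _ : ℕ => u) := fun _ => ⟨hu, huγ⟩

/-- **Small box ⟶ constant history.**  Under `HistLipschitz Λ γ β` with `FadingMemory C θ Λ` (0 ≤ θ < 1, 0 ≤ C) and `0 < δ ≤ γ`: every `v ∈ ]0, δ]^{k+1}` has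
`|β_{k+1}(v) − β_{k+1}(δ, …, δ)| ≤ Cδ∕(1−θ)` (each coordinate differs from δ by less than δ; the row sum of the moduli is ≤ C∕(1−θ)). [folklore] -/
theorem abs_sub_const_le_of_mem_box (hL : HistLipschitz Λ γ β) (hΛ : FadingMemory C θ Λ) (hθ0 : 0 ≤ θ) (hθ1 : θ < 1) (hC : 0 ≤ C)
    {δ : ℝ} (hδ : 0 < δ) (hδγ : δ ≤ γ) {k : ℕ} {v : Fin (k + 1) → ℝ} (hv : v ∈ Box δ k) :
    |β k v - β k (fun _ : Fin (k + 1) => δ)| ≤ C * δ / (1 - θ) := by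
  have hvγ : v ∈ Box γ k := box_mono hδγ k hv
  have hconst : (fun _ : Fin (k + 1) => δ) ∈ Box γ k := mem_box.mpr fun _ => ⟨hδ, hδγ⟩
  have h := hL k v (fun _ => δ) hvγ hconst
  have hterm : ∀ i : Fin (k + 1), Λ k i * |v i - δ| ≤ Λ k i * δ := by
    intro i
    have hΛi : 0 ≤ Λ k i := (hΛ k i (Nat.le_of_lt_succ i.isLt)).1
    have hvi := mem_box.mp hv i
    have habs : |v i - δ| ≤ δ := abs_sub_le_iff.mpr ⟨by linarith [hvi.2], by linarith [hvi.1]⟩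
    exact mul_le_mul_of_nonneg_left habs hΛi
  have hsum : ∑ i : Fin (k + 1), Λ k i * |v i - δ| ≤ δ * ∑ i : Fin (k + 1), Λ k i := by
    calc ∑ i : Fin (k + 1), Λ k i * |v i - δ| ≤ ∑ i : Fin (k + 1), Λ k i * δ := Finset.sum_le_sum fun i _ => hterm i
      _ = δ * ∑ i : Fin (k + 1), Λ k i := by rw [Finset.mul_sum]; exact Finset.sum_congr rfl fun i _ => mul_comm _ _
  have hrow := rowSum_le hθ0 hθ1 hC hΛ k
  have hδrow : δ * ∑ i : Fin (k + 1), Λ k i ≤ C * δ / (1 - θ) := by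
    calc δ * ∑ i : Fin (k + 1), Λ k i ≤ δ * (C / (1 - θ)) := mul_le_mul_of_nonneg_left hrow hδ.le
      _ = C * δ / (1 - θ) := by ring
  linarith [h, hsum, hδrow]

/-- **The constant-history values are Lipschitz in the constant, uniformly in the scale**: `|β_{k+1}(u,…,u) − β_{k+1}(u′,…,u′)| ≤ C|u − u′|∕(1−θ)` for `u, u′ ∈ ]0, γ]`. [folklore] -/
theorem abs_const_sub_const_le (hL : HistLipschitz Λ γ β) (hΛ : FadingMemory C θ Λ) (hθ0 : 0 ≤ θ) (hθ1 : θ < 1) (hC : 0 ≤ C)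
    {u u' : ℝ} (hu : 0 < u) (huγ : u ≤ γ) (hu' : 0 < u') (hu'γ : u' ≤ γ) (k : ℕ) :
    |β k (fun _ : Fin (k + 1) => u) - β k (fun _ : Fin (k + 1) => u')| ≤ C * |u - u'| / (1 - θ) := by
  have hcu : (fun _ : Fin (k + 1) => u) ∈ Box γ k := mem_box.mpr fun _ => ⟨hu, huγ⟩
  have hcu' : (fun _ : Fin (k + 1) => u') ∈ Box γ k := mem_box.mpr fun _ => ⟨hu', hu'γ⟩
  have h := hL k (fun _ => u) (fun _ => u') hcu hcu'
  have hsum : ∑ i : Fin (k + 1), Λ k i * |u - u'| = |u - u'| * ∑ i : Fin (k + 1), Λ k i := by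
    rw [Finset.mul_sum]; exact Finset.sum_congr rfl fun i _ => mul_comm _ _
  rw [hsum] at h
  have hrow := rowSum_le hθ0 hθ1 hC hΛ k
  calc |β k (fun _ : Fin (k + 1) => u) - β k (fun _ : Fin (k + 1) => u')| ≤ |u - u'| * ∑ i : Fin (k + 1), Λ k i := h
    _ ≤ |u - u'| * (C / (1 - θ)) := mul_le_mul_of_nonneg_left hrow (abs_nonneg _)
    _ = C * |u - u'| / (1 - θ) := by ring

/-- NE4's geometric tail along a constant history (node U2's `abs_beta_revHist_sub_betaInf_le` BY NAME): `|β_{k+1}(u,…,u) − betaInf β (u,u,…)| ≤ cθ^k∕(1−θ)`. [folklore] -/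
theorem abs_const_sub_betaInf_le (hS : ScaleShiftRate c θ γ β) (hθ1 : θ < 1) {u : ℝ} (hu : 0 < u) (huγ : u ≤ γ) (k : ℕ) :
    |β k (fun _ : Fin (k + 1) => u) - betaInf β (fun _ : ℕ => u)| ≤ c * θ ^ k / (1 - θ) :=
  abs_beta_revHist_sub_betaInf_le hS hθ1 (seqBox_const hu huγ) k

/-- **node U2's stationary functional is Lipschitz along the constant histories**: `|betaInf β (u,u,…) − betaInf β (u′,u′,…)| ≤ C|u − u′|∕(1−θ)` on ]0, γ] (the scale-uniform bound of
`abs_const_sub_const_le` passes to the limit `tendsto_betaInf`). [folklore] -/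
theorem abs_betaInf_const_sub_le (hL : HistLipschitz Λ γ β) (hΛ : FadingMemory C θ Λ) (hS : ScaleShiftRate c θ γ β)
    (hθ0 : 0 ≤ θ) (hθ1 : θ < 1) (hC : 0 ≤ C) {u u' : ℝ} (hu : 0 < u) (huγ : u ≤ γ) (hu' : 0 < u') (hu'γ : u' ≤ γ) :
    |betaInf β (fun _ : ℕ => u) - betaInf β (fun _ : ℕ => u')| ≤ C * |u - u'| / (1 - θ) := by
  have ht := ((tendsto_betaInf hS hθ1 (seqBox_const hu huγ)).sub (tendsto_betaInf hS hθ1 (seqBox_const hu' hu'γ))).abs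
  exact le_of_tendsto' ht fun k => abs_const_sub_const_le hL hΛ hθ0 hθ1 hC hu huγ hu' hu'γ k

/-! ## §2 The asymptotic constant `b⋆ = lim_{u→0⁺} betaInf β (u, u, …)` -/

/-- **THE ASYMPTOTIC CONSTANT EXISTS.**  Under the moduli and NE4 (0 ≤ θ < 1, 0 ≤ C, 0 < γ) there is a real number `b⋆` with
`|betaInf β (u,u,…) − b⋆| ≤ Cu∕(1−θ)` for every `u ∈ ]0, γ]` (Cauchy along `u_n = γ∕2^n` by the Lipschitz bound, node U2's `exists_limit_of_geomRate` BY NAME; then u_n → 0). [folklore] -/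
theorem exists_bstar (hL : HistLipschitz Λ γ β) (hΛ : FadingMemory C θ Λ) (hS : ScaleShiftRate c θ γ β)
    (hθ0 : 0 ≤ θ) (hθ1 : θ < 1) (hC : 0 ≤ C) (hγ : 0 < γ) :
    ∃ bstar : ℝ, ∀ u : ℝ, 0 < u → u ≤ γ → |betaInf β (fun _ : ℕ => u) - bstar| ≤ C * u / (1 - θ) := by
  have h1θ : 0 < 1 - θ := by linarith
  set a : ℕ → ℝ := fun n => betaInf β (fun _ : ℕ => γ * (1 / 2) ^ n) with ha
  have hun : ∀ n : ℕ, 0 < γ * (1 / 2 : ℝ) ^ n ∧ γ * (1 / 2 : ℝ) ^ n ≤ γ := fun n =>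
    ⟨by positivity, by
      have : (1 / 2 : ℝ) ^ n ≤ 1 := pow_le_one₀ (by norm_num) (by norm_num)
      nlinarith⟩
  -- consecutive differences are geometric with ratio 1/2
  have hgeom : GeomRate (C * γ / (2 * (1 - θ))) (1 / 2) (fun n => a (n + 1) - a n) := by
    intro n
    have h := abs_betaInf_const_sub_le hL hΛ hS hθ0 hθ1 hC (hun (n + 1)).1 (hun (n + 1)).2 (hun n).1 (hun n).2
    have hdiff : |γ * (1 / 2 : ℝ) ^ (n + 1) - γ * (1 / 2) ^ n| = γ * (1 / 2) ^ (n + 1) := by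
      have hp : 0 ≤ γ * (1 / 2 : ℝ) ^ n := by positivity
      rw [abs_sub_comm, abs_of_nonneg (by rw [pow_succ]; nlinarith)]
      ring
    rw [hdiff] at h
    calc |a (n + 1) - a n| ≤ C * (γ * (1 / 2) ^ (n + 1)) / (1 - θ) := h
      _ = C * γ / (2 * (1 - θ)) * (1 / 2) ^ n := by rw [pow_succ]; field_simp
  obtain ⟨bstar, -, hb⟩ := exists_limit_of_geomRate (u := a) (by norm_num : (1 / 2 : ℝ) < 1) hgeom
  refine ⟨bstar, fun u hu huγ => ?_⟩
  -- |f u − b⋆| ≤ |f u − a n| + |a n − b⋆| ≤ C(u + γ/2^n)/(1−θ) + Cγ/2^n/(1−θ), every n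
  refine le_of_forall_pos_le_add fun ε hε => ?_
  have hn : ∀ n : ℕ, |betaInf β (fun _ : ℕ => u) - bstar| ≤ C * u / (1 - θ) + 2 * C * γ / (1 - θ) * (1 / 2) ^ n := by
    intro n
    have h1 := abs_betaInf_const_sub_le hL hΛ hS hθ0 hθ1 hC hu huγ (hun n).1 (hun n).2
    have h2 := hb n
    have htri := abs_sub_le (betaInf β (fun _ : ℕ => u)) (a n) bstar
    have habs : |u - γ * (1 / 2) ^ n| ≤ u + γ * (1 / 2) ^ n :=
      abs_sub_le_iff.mpr ⟨by linarith [(hun n).1], by linarith [hu]⟩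
    have h1' : |betaInf β (fun _ : ℕ => u) - a n| ≤ C * (u + γ * (1 / 2) ^ n) / (1 - θ) := by
      refine h1.trans ?_
      rw [div_le_div_iff_of_pos_right h1θ]
      exact mul_le_mul_of_nonneg_left habs hC
    have h2' : |a n - bstar| ≤ C * γ / (1 - θ) * (1 / 2) ^ n := by
      refine h2.trans (le_of_eq ?_)
      field_simp
      ring
    have e : C * (u + γ * (1 / 2) ^ n) / (1 - θ) + C * γ / (1 - θ) * (1 / 2) ^ n =
        C * u / (1 - θ) + 2 * C * γ / (1 - θ) * (1 / 2) ^ n := by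
      field_simp; ring
    linarith [htri, h1', h2', e]
  -- choose n with the geometric term below ε
  rcases eq_or_lt_of_le (show 0 ≤ 2 * C * γ / (1 - θ) by positivity) with h0 | hpos
  · have := hn 0
    rw [← h0] at this
    linarith
  · obtain ⟨n, hnε⟩ := exists_pow_lt_of_lt_one (show 0 < ε / (2 * C * γ / (1 - θ)) by positivity) (by norm_num : (1 / 2 : ℝ) < 1)
    have : 2 * C * γ / (1 - θ) * (1 / 2) ^ n < ε := by
      have := (lt_div_iff₀ hpos).mp hnε
      linarith
    linarith [hn n]

/-- The asymptotic constant is UNIQUE (any two numbers with the defining property agree). [folklore] -/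
theorem bstar_unique (hθ1 : θ < 1) (hC : 0 ≤ C) (hγ : 0 < γ) {b₁ b₂ : ℝ}
    (h₁ : ∀ u : ℝ, 0 < u → u ≤ γ → |betaInf β (fun _ : ℕ => u) - b₁| ≤ C * u / (1 - θ))
    (h₂ : ∀ u : ℝ, 0 < u → u ≤ γ → |betaInf β (fun _ : ℕ => u) - b₂| ≤ C * u / (1 - θ)) : b₁ = b₂ := by
  have h1θ : 0 < 1 - θ := by linarith
  have key : ∀ ε : ℝ, 0 < ε → |b₁ - b₂| ≤ ε := by
    intro ε hε
    -- u := min γ (ε(1−θ)/(2(C+1)))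
    set u : ℝ := min γ (ε * (1 - θ) / (2 * (C + 1))) with hudef
    have hu : 0 < u := lt_min hγ (by positivity)
    have huγ : u ≤ γ := min_le_left _ _
    have hu2 : u ≤ ε * (1 - θ) / (2 * (C + 1)) := min_le_right _ _
    have htri : |b₁ - b₂| ≤ |betaInf β (fun _ : ℕ => u) - b₁| + |betaInf β (fun _ : ℕ => u) - b₂| := by
      have := abs_sub_abs_le_abs_sub b₁ b₂
      rw [abs_sub_comm (betaInf β _) b₁]
      exact abs_sub_le b₁ (betaInf β (fun _ : ℕ => u)) b₂
    have hsum : C * u / (1 - θ) + C * u / (1 - θ) ≤ ε := by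
      rw [← add_div, div_le_iff₀ h1θ]
      have h3 : 2 * (C + 1) * u ≤ ε * (1 - θ) := by rwa [le_div_iff₀ (by positivity), mul_comm] at hu2
      nlinarith [hu.le]
    linarith [h₁ u hu huγ, h₂ u hu huγ, htri]
  have : |b₁ - b₂| ≤ 0 := le_of_forall_pos_le_add fun ε hε => by linarith [key ε hε]
  have := abs_nonneg (b₁ - b₂)
  have hz : b₁ - b₂ = 0 := abs_eq_zero.mp (le_antisymm (by linarith) this)
  linarith

/-- As a limit: `betaInf β (u, u, …) → b⋆` as `u → 0⁺`. [folklore] -/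
theorem tendsto_betaInf_const (hθ1 : θ < 1) (hC : 0 ≤ C) (hγ : 0 < γ) {bstar : ℝ}
    (hb : ∀ u : ℝ, 0 < u → u ≤ γ → |betaInf β (fun _ : ℕ => u) - bstar| ≤ C * u / (1 - θ)) :
    Tendsto (fun u : ℝ => betaInf β (fun _ : ℕ => u)) (𝓝[>] 0) (𝓝 bstar) := by
  have h1θ : 0 < 1 - θ := by linarith
  rw [Metric.tendsto_nhdsWithin_nhds]
  intro ε hε
  refine ⟨min γ (ε * (1 - θ) / (C + 1)), lt_min hγ (by positivity), fun u hu hdist => ?_⟩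
  have hu0 : 0 < u := hu
  rw [Real.dist_eq, sub_zero, abs_of_pos hu0] at hdist
  have huγ : u ≤ γ := (hdist.trans_le (min_le_left _ _)).le
  have huε : u < ε * (1 - θ) / (C + 1) := hdist.trans_le (min_le_right _ _)
  rw [Real.dist_eq]
  refine (hb u hu0 huγ).trans_lt ?_
  rw [div_lt_iff₀ h1θ]
  have h3 : (C + 1) * u < ε * (1 - θ) := by rwa [lt_div_iff₀ (by positivity), mul_comm] at huε
  nlinarith [hu0.le]

/-! ## §3 The two-sided sandwich: near zero and deep in the ultraviolet every β-function is the one number `b⋆` -/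

/-- **THE TWO-SIDED SANDWICH.**  Under the moduli and NE4 (0 ≤ θ < 1, 0 ≤ C), with `b⋆` the asymptotic constant (`hb`) and `0 < δ ≤ γ`: for EVERY k and EVERY `v ∈ ]0, δ]^{k+1}`,
`|β_{k+1}(v) − b⋆| ≤ 2Cδ∕(1−θ) + cθ^k∕(1−θ)` — small box ⟶ constant history δ (`Cδ∕(1−θ)`), NE4 tail to `betaInf β (δ,δ,…)` (`cθ^k∕(1−θ)`), then to `b⋆` (`Cδ∕(1−θ)`). [folklore] -/
theorem abs_beta_sub_bstar_le (hL : HistLipschitz Λ γ β) (hΛ : FadingMemory C θ Λ) (hS : ScaleShiftRate c θ γ β)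
    (hθ0 : 0 ≤ θ) (hθ1 : θ < 1) (hC : 0 ≤ C) {bstar : ℝ}
    (hb : ∀ u : ℝ, 0 < u → u ≤ γ → |betaInf β (fun _ : ℕ => u) - bstar| ≤ C * u / (1 - θ))
    {δ : ℝ} (hδ : 0 < δ) (hδγ : δ ≤ γ) {k : ℕ} {v : Fin (k + 1) → ℝ} (hv : v ∈ Box δ k) :
    |β k v - bstar| ≤ 2 * C * δ / (1 - θ) + c * θ ^ k / (1 - θ) := by
  have h1 := abs_sub_const_le_of_mem_box hL hΛ hθ0 hθ1 hC hδ hδγ hv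
  have h2 := abs_const_sub_betaInf_le hS hθ1 hδ hδγ k
  have h3 := hb δ hδ hδγ
  have t1 := abs_sub_le (β k v) (β k (fun _ : Fin (k + 1) => δ)) bstar
  have t2 := abs_sub_le (β k (fun _ : Fin (k + 1) => δ)) (betaInf β (fun _ : ℕ => δ)) bstar
  have e : C * δ / (1 - θ) + C * δ / (1 - θ) = 2 * C * δ / (1 - θ) := by ring
  linarith

/-- The sandwich as node U2's EVENTUAL FLOOR with the margin `η(δ, k₀) = 2Cδ∕(1−θ) + cθ^{k₀}∕(1−θ)`: `EventualLowerH (b⋆ − η) δ k₀ β`. [folklore] -/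
theorem eventualLowerH_bstar (hL : HistLipschitz Λ γ β) (hΛ : FadingMemory C θ Λ) (hS : ScaleShiftRate c θ γ β)
    (hθ0 : 0 ≤ θ) (hθ1 : θ < 1) (hC : 0 ≤ C) {bstar : ℝ}
    (hb : ∀ u : ℝ, 0 < u → u ≤ γ → |betaInf β (fun _ : ℕ => u) - bstar| ≤ C * u / (1 - θ))
    {δ : ℝ} (hδ : 0 < δ) (hδγ : δ ≤ γ) (k₀ : ℕ) :
    EventualLowerH (bstar - (2 * C * δ / (1 - θ) + c * θ ^ k₀ / (1 - θ))) δ k₀ β := by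
  intro k v hk hv
  have h1θ : 0 < 1 - θ := by linarith
  have h := (abs_le.mp (abs_beta_sub_bstar_le hL hΛ hS hθ0 hθ1 hC hb hδ hδγ hv)).1
  have hc : 0 ≤ c := constant_nonneg_of_scaleShiftRate hS (hδ.trans_le hδγ)
  have hθk : c * θ ^ k / (1 - θ) ≤ c * θ ^ k₀ / (1 - θ) :=
    div_le_div_of_nonneg_right (mul_le_mul_of_nonneg_left (pow_le_pow_of_le_one hθ0 hθ1.le hk) hc) h1θ.le
  linarith

/-- … and the EVENTUAL CEILING with the same margin: `β_{k+1}(v) ≤ b⋆ + η(δ, k₀)` on ]0, δ]^{k+1} for k ≥ k₀. [folklore] -/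
theorem eventualUpper_bstar (hL : HistLipschitz Λ γ β) (hΛ : FadingMemory C θ Λ) (hS : ScaleShiftRate c θ γ β)
    (hθ0 : 0 ≤ θ) (hθ1 : θ < 1) (hC : 0 ≤ C) {bstar : ℝ}
    (hb : ∀ u : ℝ, 0 < u → u ≤ γ → |betaInf β (fun _ : ℕ => u) - bstar| ≤ C * u / (1 - θ))
    {δ : ℝ} (hδ : 0 < δ) (hδγ : δ ≤ γ) (k₀ : ℕ) :
    ∀ (k : ℕ) (v : Fin (k + 1) → ℝ), k₀ ≤ k → v ∈ Box δ k → β k v ≤ bstar + (2 * C * δ / (1 - θ) + c * θ ^ k₀ / (1 - θ)) := by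
  intro k v hk hv
  have h1θ : 0 < 1 - θ := by linarith
  have h := (abs_le.mp (abs_beta_sub_bstar_le hL hΛ hS hθ0 hθ1 hC hb hδ hδγ hv)).2
  have hc : 0 ≤ c := constant_nonneg_of_scaleShiftRate hS (hδ.trans_le hδγ)
  have hθk : c * θ ^ k / (1 - θ) ≤ c * θ ^ k₀ / (1 - θ) :=
    div_le_div_of_nonneg_right (mul_le_mul_of_nonneg_left (pow_le_pow_of_le_one hθ0 hθ1.le hk) hc) h1θ.le
  linarith

/-- **β′∕β → 1 IS FORCED.**  For every ε > 0 there are a box `0 < δ ≤ γ` and a threshold k₀ with `|β_{k+1}(v) − b⋆| ≤ ε` for all k ≥ k₀ and all `v ∈ ]0, δ]^{k+1}`: from scale k₀ on and near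
zero coupling the whole family of β-functions is within ε of ONE number. [folklore] -/
theorem exists_sandwich (hL : HistLipschitz Λ γ β) (hΛ : FadingMemory C θ Λ) (hS : ScaleShiftRate c θ γ β)
    (hθ0 : 0 ≤ θ) (hθ1 : θ < 1) (hC : 0 ≤ C) (hγ : 0 < γ) {bstar : ℝ}
    (hb : ∀ u : ℝ, 0 < u → u ≤ γ → |betaInf β (fun _ : ℕ => u) - bstar| ≤ C * u / (1 - θ)) {ε : ℝ} (hε : 0 < ε) :
    ∃ δ : ℝ, 0 < δ ∧ δ ≤ γ ∧ ∃ k₀ : ℕ, ∀ (k : ℕ) (v : Fin (k + 1) → ℝ), k₀ ≤ k → v ∈ Box δ k → |β k v - bstar| ≤ ε := by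
  have h1θ : 0 < 1 - θ := by linarith
  have hc : 0 ≤ c := constant_nonneg_of_scaleShiftRate hS hγ
  -- δ with 2Cδ/(1−θ) ≤ ε/2
  set δ : ℝ := min γ (ε * (1 - θ) / (4 * (C + 1))) with hδdef
  have hδ : 0 < δ := lt_min hγ (by positivity)
  have hδγ : δ ≤ γ := min_le_left _ _
  have hδε : 2 * C * δ / (1 - θ) ≤ ε / 2 := by
    have h1 : δ ≤ ε * (1 - θ) / (4 * (C + 1)) := min_le_right _ _
    have h2 : 4 * (C + 1) * δ ≤ ε * (1 - θ) := by rwa [le_div_iff₀ (by positivity), mul_comm] at h1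
    rw [div_le_iff₀ h1θ]
    nlinarith [hδ.le]
  -- k₀ with cθ^{k₀}/(1−θ) ≤ ε/2
  obtain ⟨k₀, hk₀⟩ : ∃ k₀ : ℕ, c * θ ^ k₀ / (1 - θ) ≤ ε / 2 := by
    rcases eq_or_lt_of_le hc with h0 | hcpos
    · exact ⟨0, by rw [← h0]; simp; positivity⟩
    · obtain ⟨k₀, hk⟩ := exists_pow_lt_of_lt_one (show 0 < ε / 2 * (1 - θ) / c by positivity) hθ1
      refine ⟨k₀, ?_⟩
      rw [div_le_iff₀ h1θ]
      have := (lt_div_iff₀ hcpos).mp hk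
      linarith
  refine ⟨δ, hδ, hδγ, k₀, fun k v hk hv => ?_⟩
  have h := abs_beta_sub_bstar_le hL hΛ hS hθ0 hθ1 hC hb hδ hδγ hv
  have hθk : c * θ ^ k / (1 - θ) ≤ c * θ ^ k₀ / (1 - θ) :=
    div_le_div_of_nonneg_right (mul_le_mul_of_nonneg_left (pow_le_pow_of_le_one hθ0 hθ1.le hk) hc) h1θ.le
  linarith

end

end Summit.QuantumFields.BalabanUV.Beta.EriceFlowEnclosureB12AsPrintedPointwiseFadingLimit
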